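import Summits.Ventures.PercRepro.RankDistWindowSets

/-!
# PercRepro — WINDOW FAMILIES, THE MIDDLE REGIME: between `q₁ + p₂` and `p₁ + q₂` (when `p₂ − q₂ ≤ p₁ − q₁`) the
window is cut by the `R`-counts alone, and the edge count between consecutive sizes is EXACT (p9, gen 22)

`RankDistWindowSets` proved the two monotone regimes (R1), (R2). Here, for `q₁ + p₂ ≤ u ≤ p₁ + q₂`, the window
family is `rFam u = {X : |X| = u, q₂ ≤ |X ∩ R| ≤ p₂}` (`winFam_eq_rFam`: the `L`-constraints are implied). Double
counting the inclusion graph `rFam u — rFam (u + 1)` EXACTLY: a `u`-set `X` has `n − u` supersets of size `u + 1`,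
all in `rFam (u + 1)` unless `|X ∩ R| = p₂`, when the `q₂` supersets through `R` drop out
(`card_bipartiteAbove_rFam_add`); a `(u + 1)`-set `X'` has `u + 1` subsets, all in `rFam u` unless `|X' ∩ R| = q₂`,
when the `q₂` subsets erasing an element of `R` drop out (`card_bipartiteBelow_rFam_add`). Hence
**`#rFam u · (n − u) + q₂ · Bq(u + 1) = #rFam (u + 1) · (u + 1) + q₂ · Bp(u)`** (`card_rFam_mul_add_eq`), with
`Bp(u) = #{X ∈ rFam u : |X ∩ R| = p₂} = C(|L|, u − p₂)·C(|R|, p₂)` and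
`Bq(u + 1) = #{X' ∈ rFam (u + 1) : |X' ∩ R| = q₂} = C(|L|, u + 1 − q₂)·C(|R|, q₂)` (`card_filter_card_inter_eq`).
`RankDistWindowUnimodal` turns this exact count into the unimodality of `π(u) = #rFam u / C(n, u)` on the middle
regime, and `RankDistRestrictedVandermonde` assembles it with (R1)–(R2) into the restricted Vandermonde inequality.
Nothing here moves any window of the crux.
-/

namespace PercRepro.RankDist

open Finset

variable {α : Type} [DecidableEq α]

/-! ## The fibre count: `u`-subsets of `L ∪ R` with exactly `b` elements of `R` -/

/-- **The fibre count**: `L`, `R` disjoint, `b ≤ u` — the `u`-subsets of `L ∪ R` with exactly `b` elements of `R`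
number `C(|L|, u − b)·C(|R|, b)`. -/
lemma card_filter_card_inter_eq {L R : Finset α} (hLR : Disjoint L R) {u b : ℕ} (hbu : b ≤ u) :
    (((L ∪ R).powersetCard u).filter (fun X => (X ∩ R).card = b)).card
      = L.card.choose (u - b) * R.card.choose b := by
  rw [← card_powersetCard, ← card_powersetCard, ← card_product]
  refine card_bij' (fun X _ => (X ∩ L, X ∩ R)) (fun P _ => P.1 ∪ P.2) ?_ ?_ ?_ ?_
  · intro X hX
    rw [mem_filter, mem_powersetCard] at hX
    obtain ⟨⟨hXLR, hXu⟩, hXb⟩ := hX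
    have hsum := card_inter_add_card_inter hLR hXLR
    rw [mem_product, mem_powersetCard, mem_powersetCard]
    dsimp only
    exact ⟨⟨inter_subset_right, by omega⟩, inter_subset_right, hXb⟩
  · rintro ⟨A, B⟩ hP
    rw [mem_product, mem_powersetCard, mem_powersetCard] at hP
    dsimp only at hP
    obtain ⟨⟨hAL, hAcard⟩, hBR, hBcard⟩ := hP
    have hdisj : Disjoint A B := hLR.mono hAL hBR
    rw [mem_filter, mem_powersetCard]
    dsimp only
    refine ⟨⟨union_subset_union hAL hBR, ?_⟩, ?_⟩
    · rw [card_union_of_disjoint hdisj, hAcard, hBcard]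
      omega
    · rw [union_inter_distrib_right, inter_eq_left.2 hBR,
        Finset.disjoint_iff_inter_eq_empty.1
          (disjoint_left.2 fun x hxA hxR => disjoint_left.1 hLR (hAL hxA) hxR : Disjoint A R),
        empty_union, hBcard]
  · intro X hX
    rw [mem_filter, mem_powersetCard] at hX
    dsimp only
    rw [← inter_union_distrib_left, inter_eq_left.2 hX.1.1]
  · rintro ⟨A, B⟩ hP
    rw [mem_product, mem_powersetCard, mem_powersetCard] at hP
    dsimp only at hP ⊢
    obtain ⟨⟨hAL, -⟩, hBR, -⟩ := hP
    have h1 : (A ∪ B) ∩ L = A := by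
      rw [union_inter_distrib_right, inter_eq_left.2 hAL,
        Finset.disjoint_iff_inter_eq_empty.1
          (disjoint_left.2 fun x hxB hxL => disjoint_right.1 hLR (hBR hxB) hxL : Disjoint B L),
        union_empty]
    have h2 : (A ∪ B) ∩ R = B := by
      rw [union_inter_distrib_right, inter_eq_left.2 hBR,
        Finset.disjoint_iff_inter_eq_empty.1
          (disjoint_left.2 fun x hxA hxR => disjoint_left.1 hLR (hAL hxA) hxR : Disjoint A R),
        empty_union]
    rw [h1, h2]

/-! ## The one-sided family -/

/-- The one-sided window family: the `u`-subsets of `L ∪ R` with between `q₂` and `p₂` elements of `R`. -/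
def rFam (L R : Finset α) (q₂ p₂ u : ℕ) : Finset (Finset α) :=
  ((L ∪ R).powersetCard u).filter (fun X => q₂ ≤ (X ∩ R).card ∧ (X ∩ R).card ≤ p₂)

/-- Membership in the one-sided family. -/
lemma mem_rFam {L R : Finset α} {q₂ p₂ u : ℕ} {X : Finset α} :
    X ∈ rFam L R q₂ p₂ u ↔ X ⊆ L ∪ R ∧ X.card = u ∧ q₂ ≤ (X ∩ R).card ∧ (X ∩ R).card ≤ p₂ := by
  unfold rFam
  rw [mem_filter, mem_powersetCard, and_assoc]

/-- The one-sided family consists of `u`-subsets of `L ∪ R`. -/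
lemma rFam_subset_powersetCard (L R : Finset α) (q₂ p₂ u : ℕ) :
    rFam L R q₂ p₂ u ⊆ (L ∪ R).powersetCard u :=
  filter_subset _ _

/-- **In the middle regime the window is one-sided**: for `q₁ + p₂ ≤ u ≤ p₁ + q₂` (`L`, `R` disjoint),
`winFam u = rFam u` — the `L`-constraints are implied by the `R`-constraints. -/
lemma winFam_eq_rFam {L R : Finset α} (hLR : Disjoint L R) {q₁ p₁ q₂ p₂ u : ℕ} (hu₁ : q₁ + p₂ ≤ u)
    (hu₂ : u ≤ p₁ + q₂) : winFam L R q₁ p₁ q₂ p₂ u = rFam L R q₂ p₂ u := by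
  ext X
  rw [mem_winFam, mem_rFam]
  constructor
  · rintro ⟨hX, hXu, -, -, h3, h4⟩
    exact ⟨hX, hXu, h3, h4⟩
  · rintro ⟨hX, hXu, h3, h4⟩
    have hsum := card_inter_add_card_inter hLR hX
    exact ⟨hX, hXu, by omega, by omega, h3, h4⟩

/-! ## The exact degrees -/

/-- **The upper degree in the one-sided family**: a member `X` of `rFam u` has `n − u` supersets in `rFam (u + 1)`,
less `q₂` when `|X ∩ R| = p₂` (`|R| = p₂ + q₂`). -/
lemma card_bipartiteAbove_rFam_add {L R : Finset α} (hLR : Disjoint L R) {q₂ p₂ : ℕ} (hR : R.card = p₂ + q₂)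
    {u : ℕ} {X : Finset α} (hX : X ∈ rFam L R q₂ p₂ u) :
    ((rFam L R q₂ p₂ (u + 1)).bipartiteAbove (fun X X' => X ⊆ X') X).card
      + (if (X ∩ R).card = p₂ then q₂ else 0) = (L ∪ R).card - u := by
  obtain ⟨hXLR, hXu, h3, h4⟩ := mem_rFam.1 hX
  have hXpow : X ∈ (L ∪ R).powersetCard u := mem_powersetCard.2 ⟨hXLR, hXu⟩
  have hsum := card_inter_add_card_inter hLR hXLR
  have hn : (L ∪ R).card = L.card + R.card := card_union_of_disjoint hLR
  by_cases hp : (X ∩ R).card = p₂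
  · rw [if_pos hp]
    -- the supersets in the family are exactly the `insert x X`, `x ∈ L ∖ X`
    have heq : (rFam L R q₂ p₂ (u + 1)).bipartiteAbove (fun X X' => X ⊆ X') X
        = (L \ X).image (fun x => insert x X) := by
      ext X'
      rw [mem_bipartiteAbove, mem_image]
      constructor
      · rintro ⟨hX'fam, hXX'⟩
        obtain ⟨hX'LR, hX'u, -, hX'4⟩ := mem_rFam.1 hX'fam
        have hcard : (X' \ X).card = 1 := by
          rw [card_sdiff_of_subset hXX', hX'u, hXu]
          omega
        obtain ⟨y, hy⟩ := card_eq_one.1 hcard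
        have hyX' : y ∈ X' \ X := by
          rw [hy]
          exact mem_singleton_self y
        rw [mem_sdiff] at hyX'
        have hX'eq : X' = insert y X := by
          ext z
          rw [mem_insert]
          constructor
          · intro hz
            by_cases hzX : z ∈ X
            · exact Or.inr hzX
            · left
              have : z ∈ X' \ X := mem_sdiff.2 ⟨hz, hzX⟩
              rw [hy, mem_singleton] at this
              exact this
          · rintro (rfl | hz)
            · exact hyX'.1
            · exact hXX' hz
        refine ⟨y, ?_, hX'eq.symm⟩
        rw [mem_sdiff]
        refine ⟨?_, hyX'.2⟩
        rcases mem_union.1 (hX'LR hyX'.1) with hyL | hyR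
        · exact hyL
        · exfalso
          obtain ⟨-, e2⟩ := card_inter_insert_of_mem_right hLR hyR hyX'.2
          rw [hX'eq, e2, hp] at hX'4
          omega
      · rintro ⟨x, hx, rfl⟩
        rw [mem_sdiff] at hx
        obtain ⟨e1, e2⟩ := card_inter_insert_of_mem_left hLR hx.1 hx.2
        refine ⟨?_, subset_insert x X⟩
        rw [mem_rFam, e2]
        exact ⟨insert_subset (mem_union_left R hx.1) hXLR, by rw [card_insert_of_notMem hx.2, hXu], h3, h4⟩
    have hinj : Set.InjOn (fun x => insert x X) (L \ X : Finset α) := by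
      intro x hx y hy hxy
      rw [coe_sdiff, Set.mem_sdiff, mem_coe, mem_coe] at hx hy
      dsimp only at hxy
      have : x ∈ insert y X := by
        rw [← hxy]
        exact mem_insert_self x X
      rw [mem_insert] at this
      rcases this with h | h
      · exact h
      · exact absurd h hx.2
    have hLX := card_sdiff_add_card_inter L X
    rw [inter_comm] at hLX
    have hXL : (X ∩ L).card ≤ L.card := card_le_card inter_subset_right
    rw [heq, card_image_of_injOn hinj]
    omega
  · rw [if_neg hp, Nat.add_zero]
    apply le_antisymm
    · exact card_bipartiteAbove_insert_le _ (rFam_subset_powersetCard L R q₂ p₂ (u + 1)) hXpow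
    · refine le_card_bipartiteAbove_insert _ hXpow ?_
      intro x hx
      rw [mem_sdiff] at hx
      rw [mem_rFam]
      refine ⟨insert_subset hx.1 hXLR, by rw [card_insert_of_notMem hx.2, hXu], ?_⟩
      rcases mem_union.1 hx.1 with hxL | hxR
      · obtain ⟨-, e2⟩ := card_inter_insert_of_mem_left hLR hxL hx.2
        rw [e2]
        exact ⟨h3, h4⟩
      · obtain ⟨-, e2⟩ := card_inter_insert_of_mem_right hLR hxR hx.2
        rw [e2]
        constructor <;> omega

/-- **The lower degree in the one-sided family**: a member `X'` of `rFam (u + 1)` has `u + 1` subsets in `rFam u`,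
less `q₂` when `|X' ∩ R| = q₂`. -/
lemma card_bipartiteBelow_rFam_add {L R : Finset α} (hLR : Disjoint L R) {q₂ p₂ : ℕ} {u : ℕ} {X' : Finset α}
    (hX' : X' ∈ rFam L R q₂ p₂ (u + 1)) :
    ((rFam L R q₂ p₂ u).bipartiteBelow (fun X X' => X ⊆ X') X').card
      + (if (X' ∩ R).card = q₂ then q₂ else 0) = u + 1 := by
  obtain ⟨hX'LR, hX'u, h3, h4⟩ := mem_rFam.1 hX'
  have hX'pow : X' ∈ (L ∪ R).powersetCard (u + 1) := mem_powersetCard.2 ⟨hX'LR, hX'u⟩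
  have hsum := card_inter_add_card_inter hLR hX'LR
  by_cases hq : (X' ∩ R).card = q₂
  · rw [if_pos hq]
    have heq : (rFam L R q₂ p₂ u).bipartiteBelow (fun X X' => X ⊆ X') X'
        = (X' ∩ L).image (fun y => X'.erase y) := by
      ext X
      rw [mem_bipartiteBelow, mem_image]
      constructor
      · rintro ⟨hXfam, hXX'⟩
        obtain ⟨-, hXu, hX3, -⟩ := mem_rFam.1 hXfam
        have hcard : (X' \ X).card = 1 := by
          rw [card_sdiff_of_subset hXX', hX'u, hXu]
          omega
        obtain ⟨y, hy⟩ := card_eq_one.1 hcard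
        have hyX' : y ∈ X' \ X := by
          rw [hy]
          exact mem_singleton_self y
        rw [mem_sdiff] at hyX'
        have hXeq : X = X'.erase y := by
          ext z
          rw [mem_erase]
          constructor
          · intro hz
            exact ⟨fun h => hyX'.2 (h ▸ hz), hXX' hz⟩
          · rintro ⟨hzy, hz⟩
            by_contra hzX
            have : z ∈ X' \ X := mem_sdiff.2 ⟨hz, hzX⟩
            rw [hy, mem_singleton] at this
            exact hzy this
        refine ⟨y, ?_, hXeq.symm⟩
        rw [mem_inter]
        refine ⟨hyX'.1, ?_⟩
        rcases mem_union.1 (hX'LR hyX'.1) with hyL | hyR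
        · exact hyL
        · exfalso
          obtain ⟨-, e2⟩ := card_inter_erase_of_mem_right hLR hyR hyX'.1
          rw [← hXeq, hq] at e2
          omega
      · rintro ⟨y, hy, rfl⟩
        rw [mem_inter] at hy
        obtain ⟨-, e2⟩ := card_inter_erase_of_mem_left hLR hy.2 hy.1
        refine ⟨?_, erase_subset y X'⟩
        rw [mem_rFam, e2]
        exact ⟨(erase_subset y X').trans hX'LR, by rw [card_erase_of_mem hy.1, hX'u]; rfl, h3, h4⟩
    have hinj : Set.InjOn (fun y => X'.erase y) (X' ∩ L : Finset α) := by
      intro x hx y hy hxy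
      rw [coe_inter, Set.mem_inter_iff, mem_coe, mem_coe] at hx hy
      dsimp only at hxy
      by_contra hne
      have : x ∈ X'.erase y := mem_erase.2 ⟨hne, hx.1⟩
      rw [← hxy, mem_erase] at this
      exact this.1 rfl
    rw [heq, card_image_of_injOn hinj]
    omega
  · rw [if_neg hq, Nat.add_zero]
    apply le_antisymm
    · exact card_bipartiteBelow_erase_le _ (rFam_subset_powersetCard L R q₂ p₂ u) hX'pow
    · refine le_card_bipartiteBelow_erase _ hX'pow ?_
      intro y hy
      rw [mem_rFam]
      refine ⟨(erase_subset y X').trans hX'LR, by rw [card_erase_of_mem hy, hX'u]; rfl, ?_⟩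
      rcases mem_union.1 (hX'LR hy) with hyL | hyR
      · obtain ⟨-, e2⟩ := card_inter_erase_of_mem_left hLR hyL hy
        rw [e2]
        exact ⟨h3, h4⟩
      · obtain ⟨-, e2⟩ := card_inter_erase_of_mem_right hLR hyR hy
        constructor <;> omega

/-! ## The exact edge count -/

/-- The boundary counts: the members of `rFam u` with exactly `p₂` elements of `R`, and the members of
`rFam (u + 1)` with exactly `q₂`. -/
def bpCount (L R : Finset α) (q₂ p₂ u : ℕ) : ℕ :=
  ((rFam L R q₂ p₂ u).filter (fun X => (X ∩ R).card = p₂)).card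

/-- The members of `rFam (u + 1)` with exactly `q₂` elements of `R`. -/
def bqCount (L R : Finset α) (q₂ p₂ u : ℕ) : ℕ :=
  ((rFam L R q₂ p₂ (u + 1)).filter (fun X => (X ∩ R).card = q₂)).card

/-- **The exact double counting between `rFam u` and `rFam (u + 1)`**:
`#rFam u · (n − u) + q₂ · Bq(u + 1) = #rFam (u + 1) · (u + 1) + q₂ · Bp(u)`. -/
theorem card_rFam_mul_add_eq {L R : Finset α} (hLR : Disjoint L R) {q₂ p₂ : ℕ} (hR : R.card = p₂ + q₂)
    (u : ℕ) :
    (rFam L R q₂ p₂ u).card * ((L ∪ R).card - u) + q₂ * bqCount L R q₂ p₂ u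
      = (rFam L R q₂ p₂ (u + 1)).card * (u + 1) + q₂ * bpCount L R q₂ p₂ u := by
  have hE := sum_card_bipartiteAbove_eq_sum_card_bipartiteBelow (s := rFam L R q₂ p₂ u)
    (t := rFam L R q₂ p₂ (u + 1)) (r := fun X X' => X ⊆ X')
  have h1 : (rFam L R q₂ p₂ u).card * ((L ∪ R).card - u)
      = (∑ X ∈ rFam L R q₂ p₂ u, ((rFam L R q₂ p₂ (u + 1)).bipartiteAbove (fun X X' => X ⊆ X') X).card)
        + q₂ * bpCount L R q₂ p₂ u := by
    calc (rFam L R q₂ p₂ u).card * ((L ∪ R).card - u)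
        = ∑ _X ∈ rFam L R q₂ p₂ u, ((L ∪ R).card - u) := by rw [sum_const, smul_eq_mul]
      _ = ∑ X ∈ rFam L R q₂ p₂ u, (((rFam L R q₂ p₂ (u + 1)).bipartiteAbove (fun X X' => X ⊆ X') X).card
            + (if (X ∩ R).card = p₂ then q₂ else 0)) :=
          sum_congr rfl (fun X hX => (card_bipartiteAbove_rFam_add hLR hR hX).symm)
      _ = (∑ X ∈ rFam L R q₂ p₂ u, ((rFam L R q₂ p₂ (u + 1)).bipartiteAbove (fun X X' => X ⊆ X') X).card)
            + ∑ X ∈ rFam L R q₂ p₂ u, (if (X ∩ R).card = p₂ then q₂ else 0) := sum_add_distrib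
      _ = _ := by
          unfold bpCount
          rw [← sum_filter, sum_const, smul_eq_mul, mul_comm]
  have h2 : (rFam L R q₂ p₂ (u + 1)).card * (u + 1)
      = (∑ X' ∈ rFam L R q₂ p₂ (u + 1), ((rFam L R q₂ p₂ u).bipartiteBelow (fun X X' => X ⊆ X') X').card)
        + q₂ * bqCount L R q₂ p₂ u := by
    calc (rFam L R q₂ p₂ (u + 1)).card * (u + 1)
        = ∑ _X' ∈ rFam L R q₂ p₂ (u + 1), (u + 1) := by rw [sum_const, smul_eq_mul]
      _ = ∑ X' ∈ rFam L R q₂ p₂ (u + 1), (((rFam L R q₂ p₂ u).bipartiteBelow (fun X X' => X ⊆ X') X').card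
            + (if (X' ∩ R).card = q₂ then q₂ else 0)) :=
          sum_congr rfl (fun X' hX' => (card_bipartiteBelow_rFam_add hLR hX').symm)
      _ = (∑ X' ∈ rFam L R q₂ p₂ (u + 1), ((rFam L R q₂ p₂ u).bipartiteBelow (fun X X' => X ⊆ X') X').card)
            + ∑ X' ∈ rFam L R q₂ p₂ (u + 1), (if (X' ∩ R).card = q₂ then q₂ else 0) := sum_add_distrib
      _ = _ := by
          unfold bqCount
          rw [← sum_filter, sum_const, smul_eq_mul, mul_comm]
  rw [h1, h2, hE]
  ring

end PercRepro.RankDist
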